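import Summits.QuantumFields.BalabanUV.T4Continuum.Support.NE9CauchyOpLinear
import Summits.QuantumFields.BalabanUV.T4Continuum.Support.NE9RemainderPieceCoupling

/-!
# NE9RemainderPieceLinear — `remPiece(A) − remPiece(A′)` IS the (1.23)-functional of the remainder difference, hence the
DISPLAYED SPECIES' per-piece COUPLING RESPONSE (leaf A3) in CLOSED FORM (cell `pub-balaban`, T4-DAG §2 node U3 ∕ §6 NE9; NE9
formalisation swarm, unit `b2b-balaban-t4-ne9-formalise-leaf-03` gen 4; own-initiative micro-item «A3-LIN», CLAIMS.log l.8538,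
SPECIES half — the engine is the sibling `NE9CauchyOpLinear`; companion of this lineage's `NE9RemainderPieceCoupling` p211959,
whose §4 and cross-read (CLAIMS.log l.8492 (x2)) left exactly this identification «instantiation-side (linearity of INTEGRABLE
circle integrals)»)

HONEST FRAMING (T4-DAG PAGE 1).  Rung (B)+1 of the FINITE-VOLUME T⁴ programme — existence AND uniqueness of the ε → 0 limit
of gauge-invariant observables on a fixed torus; NOT infinite volume, NOT a mass gap, NOT the Clay problem.  NE9
(`T4OutputRate.NE9` ∧ `FadingMemory`) is a cell NEW ESTIMATE, NOT PRINTED, and is NOT discharged here («NE9 ⇐ the named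
binders»); spine 0∕9; 0∕18 skeleton leaves instantiated on Bałaban's objects (O-NE9-1).  HONEST DEPENDENCY (cell line,
verbatim): continuum YM on T⁴ ⇐ BetaPertH ∧ nine spine estimates (0/9 proved); BetaPertH ⇐ (D1) ∧ (D4) ∧ CAP+tail; G-an2-4
gates asym, D1 and NE2/3/4.  Pure calculus on an abstract complex normed configuration space `E` and the row owner's
FORM-level objects `NE9Lemma1RemainderPiece.dirRem` ∕ `remPiece` (t4-ne9-p1 g23); [I] = [Balaban1987RG1] (CMP **109**), [II] =
[Balaban1988RG2Cluster] (CMP **116**) quoted for TYPES only (ABSOLUTE RULE: nothing printed in the audited series is asserted).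
No `def`, no Prop-valued definition; `FlowStep.BetaPertH`, (B), (B^μ) do not occur.

WHERE THIS SITS.  Leaf A3 (`hTcup`) on the (1.23)∕(1.33)-piece form is reduced by `NE9PieceCouplingModulus.channelCouplingModulus
_piece` (p211558) to ONE displayed per-piece COUPLING-RESPONSE bound.  For the DISPLAYED species — the fifth-order remainder
piece of [I] (3.34)∕[II] (1.23), typed by the owner as `remPiece ρ r l H n A s σ = (2πi)⁻¹∮_{|t|=r}dt∕t² · cauchyOp ρ l (s′ σ′ ↦
dirRem H n (A t s′ σ′)) s σ`, the coupling entering through the DIRECTION MAP `A` (the shift 𝐇_k(s): [I] (2.12) p. 268, [II]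
(1.21)–(1.23) p. 7) — p211959 proved `norm_remPieceDiff_le` for the functional of the remainder DIFFERENCE and LEFT OPEN its
identification with `remPiece(…A…) − remPiece(…A′…)`.  THIS FILE supplies it under the natural regularity, CONTINUITY OF THE
DIRECTION MAPS ON THE CONTOURS (a NEW displayed binder of the species; TYPE: [II] p. 7 builds 𝐇_k(s(Y₀), B′) from the
s(Δ)-interpolated operators of (1.10)∕(1.21) and continues it analytically to |s(Δ)| ≤ e^{κ₁} — *"we represent all derivatives
by the Cauchy formula"*, (1.23); asserted here for nothing of Bałaban's):
* §2 **`tail_eq_circleIntegral`** (the Newton–Taylor coefficients `B11SchwarzRemainder.tail f m 0` of an analytic `f` as the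
  Cauchy integrals `(2πi)⁻¹∮_{|z|=r₁} z^{−(m+1)}f(z)dz`), `dirRem_eq_sub_sum`, **`continuousOn_dirRem`**: `A ↦ dirRem H n A` is
  continuous on `‖A‖ ≤ a` for `H` analytic on `‖z‖ < R`, `0 < a < R` (parametric Cauchy integrals over `|τ| = 1`; NO sup bound on
  `H` is used), and **`continuousOn_dirRem_ball`** — the boundedness-free FULL-BALL form `DifferentiableOn ℂ H (ball 0 R) →
  ContinuousOn (dirRem H n ·) (ball 0 R)` that crew row (w16) (`PieceAdditiveOn` on the analytic class, CLAIMS.log l.8684 ∕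
  l.8808) consumes BY NAME.
* §3 `movesClosed_constraint`; **`remPiece_sub_remPiece`** — THE IDENTITY (the sibling's `pieceOp_sub` with the integrand
  `(t, s, σ) ↦ dirRem H n (A t s σ)`, continuous by §2); and the theorem of this leaf **`norm_remPiece_sub_remPiece_le`**:
  `‖remPiece e^{κ₁} r l H n A s σ − remPiece e^{κ₁} r l H n A′ s σ‖ ≤ (1∕r)·(2ⁿ·(2M∕(R−R′))·(R′∕a)·δ)·(a∕R′)ⁿ)·exp(−(κ₁−1)·#l)` for
  `H` analytic with sup `M` on `‖z‖ < R`, `0 < a < R′ < R`, direction maps continuous on the contours with norms `≤ a` and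
  `‖A − A′‖ ≤ δ` there (↔ `δ = a₁·|s − s′|`, TYPE (1.21)) — p211959's `norm_remPieceDiff_le` carried through the identity: the
  displayed per-piece coupling response `hresp` of p211558 for the displayed species, in closed form, gain `(a∕R′)^{n−1}` kept.
* §4 non-vacuity: both new binders are met by the explicit direction map `t•v + σ(Δ₀)•w` (`fun_prop` ∕ triangle inequality).
NOT TAKEN (the row owner's items (A)∕(B)∕(C), CLAIMS.log l.8319): the class-relative piece form, the species instance on
`NE9ComplexEncoding.doubleCarriers`, additivity of `remPiece` in the OLD TERM `H` (the sibling's `cauchyOp_add` and §2 are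
suppliers for it BY NAME).  NOT PRINTED and not claimed: anything about Bałaban's 𝐇_k, the domain inclusions (I.3.36)–(3.53),
or that his (1.23) pieces are these `remPiece`s (O-NE9-1).  DISGUISE TEST: one analytic term, one polymer functional, two
DIRECTIONS — no history, no renormalised term; not NE9.

WHAT IS PROVED (kernel, `[folklore]`; 0 sorry, 0 `def`): §2 `tail_eq_circleIntegral`, `dirRem_eq_sub_sum`, `continuousOn_dirRem`,
`continuousOn_dirRem_ball`;
§3 `movesClosed_constraint`, `remPiece_sub_remPiece`, `norm_remPiece_sub_remPiece_le`; §4 two `example`s.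

References (TYPES only): T. Bałaban, *Renormalization group approach to lattice gauge field theories. II. Cluster expansions*,
Commun. Math. Phys. **116** (1988) 1–22 [Balaban1988RG2Cluster], (1.10) p. 4, (1.21)–(1.24) p. 7; T. Bałaban, *Renormalization
group approach to lattice gauge field theories. I*, Commun. Math. Phys. **109** (1987) 249–301 [Balaban1987RG1], (2.12) p. 268,
(3.34)–(3.36) p. 277, (3.54) p. 280.  Summits-side NEW work (LEAN PLACEMENT RULE); imports the sibling engine and this lineage's
`NE9RemainderPieceCoupling` (hence the owner's `NE9Lemma1RemainderPiece`, the tree's `B13Sect1Arith` ∕ `B11SchwarzRemainder`) BY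
NAME; modifies nothing; no END face re-wired.  Value = the instantiation-side identification closing the A3 chain for the
displayed species at FORM level, NOT summit progress.
-/

noncomputable section

namespace Summit.QuantumFields.BalabanUV.T4Continuum.NE9RemainderPieceLinear

open scoped BigOperators
open Metric Set Complex
open Literature.MathematicalPhysics.QuantumFieldTheory.Balaban1983to89
open Literature.MathematicalPhysics.QuantumFieldTheory.Balaban1983to89.B13Sect1Arith (cauchyOp)
open Literature.MathematicalPhysics.QuantumFieldTheory.Balaban1983to89.B11SchwarzRemainder (tail tail_zero tail_succ tail_succ')
open Summit.QuantumFields.BalabanUV.T4Continuum.NE9Lemma1RemainderPiece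
open Summit.QuantumFields.BalabanUV.T4Continuum.NE9RemainderPieceCoupling
open Summit.QuantumFields.BalabanUV.T4Continuum.NE9CauchyOpLinear

variable {F : Type*} [NormedAddCommGroup F] [NormedSpace ℂ F]

/-! ## §2 The directional Taylor remainder is continuous in the direction (Newton–Taylor coefficients as Cauchy integrals) -/

section Direction

variable [CompleteSpace F]

/-- **THE NEWTON–TAYLOR COEFFICIENTS AS CAUCHY INTEGRALS.**  For `f` analytic on `|z| < r` and `0 < r₁ < r`, the m-th
iterated divided slope at `0` (`B11SchwarzRemainder.tail f m 0`, the m-th Taylor coefficient) equals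
`(2πi)⁻¹∮_{|z|=r₁} z^{−(m+1)} f(z) dz`.  Induction on `m`: `tail f (m+1) = tail (dslope f 0) m`, `dslope f 0 z = z⁻¹(f z − f 0)`
off the origin, and `∮ z^{−(m+2)} dz = 0`. [folklore] -/
theorem tail_eq_circleIntegral {r r₁ : ℝ} (hr₁ : 0 < r₁) (hr : r₁ < r) :
    ∀ (m : ℕ) (f : ℂ → F), DifferentiableOn ℂ f (ball 0 r) →
      tail f m 0 = (2 * Real.pi * I : ℂ)⁻¹ • ∮ z in C(0, r₁), (z ^ (m + 1))⁻¹ • f z := by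
  intro m
  induction m with
  | zero =>
    intro f hf
    have h := (hf.mono (closedBall_subset_ball hr)).circleIntegral_sub_inv_smul (mem_ball_self hr₁)
    simp only [sub_zero] at h
    simp only [zero_add, pow_one, tail_zero, h, inv_smul_smul₀ two_pi_I_ne_zero]
  | succ m ih =>
    intro f hf
    have hR : 0 < r := hr₁.trans hr
    have hdf : DifferentiableOn ℂ (dslope f 0) (ball 0 r) :=
      (Complex.differentiableOn_dslope (ball_mem_nhds (0:ℂ) hR)).mpr hf
    rw [tail_succ', ih (dslope f 0) hdf]
    congr 1
    have hfc : ContinuousOn f (sphere (0:ℂ) r₁) :=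
      hf.continuousOn.mono (sphere_subset_closedBall.trans (closedBall_subset_ball hr))
    have hz0 : ∀ z ∈ sphere (0:ℂ) r₁, z ≠ 0 := by
      intro z hz h0
      have : ‖z‖ = r₁ := by simpa using hz
      rw [h0, norm_zero] at this
      exact hr₁.ne' this.symm
    have hpow : ∀ k : ℕ, ContinuousOn (fun z : ℂ => (z ^ k)⁻¹) (sphere (0:ℂ) r₁) := fun k =>
      ContinuousOn.inv₀ (by fun_prop) fun z hz => pow_ne_zero k (hz0 z hz)
    have hA : CircleIntegrable (fun z => (z ^ (m + 1 + 1))⁻¹ • f z) 0 r₁ :=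
      ((hpow (m + 1 + 1)).smul hfc).circleIntegrable hr₁.le
    have hB : CircleIntegrable (fun z => (z ^ (m + 1 + 1))⁻¹ • f 0) 0 r₁ :=
      ((hpow (m + 1 + 1)).smul continuousOn_const).circleIntegrable hr₁.le
    have hcongr : (∮ z in C(0, r₁), (z ^ (m + 1))⁻¹ • dslope f 0 z) =
        ∮ z in C(0, r₁), ((z ^ (m + 1 + 1))⁻¹ • f z - (z ^ (m + 1 + 1))⁻¹ • f 0) := by
      refine circleIntegral.integral_congr hr₁.le fun z hz => ?_
      have hsc : (z ^ (m + 1))⁻¹ * z⁻¹ = (z ^ (m + 1 + 1))⁻¹ := by rw [← mul_inv, ← pow_succ]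
      rw [dslope_of_ne _ (hz0 z hz), slope_def_module, sub_zero, smul_sub, smul_sub, smul_smul, smul_smul, hsc]
    have hvan : (∮ z in C(0, r₁), (z ^ (m + 1 + 1))⁻¹ • f 0) = 0 := by
      rw [circleIntegral.integral_smul_const]
      have h0 : (∮ z in C(0, r₁), (z ^ (m + 1 + 1))⁻¹) = 0 := by
        have hfun : (fun z : ℂ => (z ^ (m + 1 + 1))⁻¹) = fun z => (z - 0) ^ (-((m + 1 + 1 : ℕ) : ℤ)) := by
          funext z; rw [sub_zero, zpow_neg, zpow_natCast]
        rw [hfun]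
        exact circleIntegral.integral_sub_zpow_of_ne (by omega) 0 0 r₁
      rw [h0, zero_smul]
    rw [hcongr, circleIntegral.integral_sub hA hB, hvan, sub_zero]

variable {E : Type*} [NormedAddCommGroup E] [NormedSpace ℂ E]

/-- The directional remainder in closed form on `‖A‖ ≤ a < R` (`0 < a`): `dirRem H n A = H A − Σ_{m<n}
(2πi)⁻¹∮_{|τ|=1} τ^{−(m+1)} H(τ•A) dτ` — the slice `τ ↦ H(τ•A)` is analytic on `|τ| < R/a > 1`. [folklore] -/
theorem dirRem_eq_sub_sum {H : E → F} {R a : ℝ} (hH : DifferentiableOn ℂ H (ball 0 R)) (ha : 0 < a) (haR : a < R)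
    (n : ℕ) {A : E} (hA : ‖A‖ ≤ a) :
    dirRem H n A = H A - ∑ m ∈ Finset.range n,
      (2 * Real.pi * I : ℂ)⁻¹ • ∮ τ in C(0, 1), (τ ^ (m + 1))⁻¹ • H (τ • A) := by
  have hslice : DifferentiableOn ℂ (fun τ : ℂ => H (τ • A)) (ball 0 (R / a)) :=
    differentiableOn_slice_of_norm_le hH ha le_rfl hA
  have h1 : (1:ℝ) < R / a := by rwa [lt_div_iff₀ ha, one_mul]
  unfold dirRem taylorRem taylorHead
  simp only [one_pow, one_smul]
  congr 1
  exact Finset.sum_congr rfl fun m _ => tail_eq_circleIntegral one_pos h1 m _ hslice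

/-- **THE DIRECTIONAL REMAINDER IS CONTINUOUS IN THE DIRECTION (kernel).**  For `H` analytic on `‖z‖ < R` and `0 < a < R`,
`A ↦ dirRem H n A` is continuous on the closed ball `‖A‖ ≤ a` (each Newton–Taylor coefficient is a parametric Cauchy
integral of the continuous `(A, τ) ↦ τ^{−(m+1)}H(τ•A)` over `|τ| = 1`). [folklore] -/
theorem continuousOn_dirRem {H : E → F} {R a : ℝ} (hH : DifferentiableOn ℂ H (ball 0 R)) (ha : 0 < a) (haR : a < R)
    (n : ℕ) : ContinuousOn (fun A => dirRem H n A) (closedBall (0:E) a) := by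
  have hHc : ContinuousOn H (ball 0 R) := hH.continuousOn
  have hsub : closedBall (0:E) a ⊆ ball 0 R := closedBall_subset_ball haR
  have hterm : ∀ m : ℕ, ContinuousOn
      (fun A : E => (2 * Real.pi * I : ℂ)⁻¹ • ∮ τ in C(0, 1), (τ ^ (m + 1))⁻¹ • H (τ • A)) (closedBall (0:E) a) := by
    intro m
    refine (continuousOn_circleIntegral_of_continuousOn zero_le_one
      (G := fun (A : E) (τ : ℂ) => (τ ^ (m + 1))⁻¹ • H (τ • A)) ?_).const_smul _
    refine ContinuousOn.smul ?_ ?_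
    · refine ContinuousOn.inv₀ (by fun_prop) fun p hp => pow_ne_zero _ ?_
      have h1 : ‖p.2‖ = 1 := by simpa using hp.2
      intro h0
      rw [h0, norm_zero] at h1
      exact zero_ne_one h1
    · refine hHc.comp (f := fun p : E × ℂ => p.2 • p.1) (Continuous.continuousOn (by fun_prop)) fun p hp => ?_
      have h1 : ‖p.2‖ = 1 := by simpa using hp.2
      have h2 : ‖p.1‖ ≤ a := mem_closedBall_zero_iff.mp hp.1
      rw [mem_ball_zero_iff, norm_smul, h1, one_mul]
      exact lt_of_le_of_lt h2 haR
  have hg : ContinuousOn (fun A : E => H A - ∑ m ∈ Finset.range n,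
      (2 * Real.pi * I : ℂ)⁻¹ • ∮ τ in C(0, 1), (τ ^ (m + 1))⁻¹ • H (τ • A)) (closedBall (0:E) a) :=
    (hHc.mono hsub).sub (continuousOn_finsetSum _ fun m _ => hterm m)
  exact hg.congr fun A hA => dirRem_eq_sub_sum hH ha haR n (mem_closedBall_zero_iff.mp hA)

/-- **BOUNDEDNESS-FREE, FULL-BALL FORM** (the shape crew row (w16) consumes, CLAIMS.log l.8808): for EVERY `H` analytic on
the open ball `‖z‖ < R`, `A ↦ dirRem H n A` is continuous on that open ball (each point lies inside a closed ball
`‖A‖ ≤ a < R`, on which the previous lemma applies; no sup bound on `H` is used anywhere). [folklore] -/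
theorem continuousOn_dirRem_ball {H : E → F} {R : ℝ} (hH : DifferentiableOn ℂ H (ball 0 R)) (n : ℕ) :
    ContinuousOn (fun A => dirRem H n A) (ball (0:E) R) := by
  intro A hA
  have hAR : ‖A‖ < R := mem_ball_zero_iff.mp hA
  have hA0 : 0 ≤ ‖A‖ := norm_nonneg A
  have ha : 0 < (‖A‖ + R) / 2 := by linarith
  have haR : (‖A‖ + R) / 2 < R := by linarith
  have hAa : ‖A‖ < (‖A‖ + R) / 2 := by linarith
  have hc := continuousOn_dirRem hH ha haR n
  have hnhds : closedBall (0:E) ((‖A‖ + R) / 2) ∈ nhds A :=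
    Filter.mem_of_superset (isOpen_ball.mem_nhds (mem_ball_zero_iff.mpr hAa)) ball_subset_closedBall
  exact (hc.continuousAt hnhds).continuousWithinAt

end Direction

/-! ## §3 The displayed species: `remPiece(A) − remPiece(A′)` IS the functional of the remainder difference -/

section Species

variable {E : Type*} [NormedAddCommGroup E] [NormedSpace ℂ E] [CompleteSpace F] {ι : Type*} [DecidableEq ι]

omit [CompleteSpace F] in
/-- The constraint set of (1.23) — every listed `s(Δ) ∈ [0,1]`, `|σ(Δ)| = ρ` — is closed under the moves of the iterated
operation (the device of `B13Sect1Arith.norm_cauchyOp_le'`). [folklore] -/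
theorem movesClosed_constraint (ρ : ℝ) (l : List ι) :
    ∀ (s : ι → ℝ) (σ : ι → ℂ), (∀ i ∈ l, s i ∈ Icc (0:ℝ) 1 ∧ σ i ∈ sphere (0:ℂ) ρ) →
      ∀ i ∈ l, ∀ u ∈ Icc (0:ℝ) 1, ∀ z ∈ sphere (0:ℂ) ρ,
        ∀ j ∈ l, Function.update s i u j ∈ Icc (0:ℝ) 1 ∧ Function.update σ i z j ∈ sphere (0:ℂ) ρ := by
  intro s σ hsσ i _ u hu z hz j hj
  by_cases hji : j = i
  · subst hji; simpa using ⟨hu, by simpa using hz⟩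
  · simpa [Function.update_of_ne hji] using hsσ j hj

/-- **`remPiece(A) − remPiece(A′)` IS THE (1.23)-FUNCTIONAL OF THE REMAINDER DIFFERENCE (kernel; the identity p211959 §4
left instantiation-side).**  For an old term `H` analytic on `‖z‖ < R`, `0 < a < R`, `ρ > 1`, `r > 0`, and two direction maps
`A`, `A′` CONTINUOUS ON THE CONTOURS `{|t| = r} × {s(Δ) ∈ [0,1], |σ(Δ)| = ρ (Δ ∈ l)}` with norms `≤ a` there, the difference
of the owner's (1.23)-functionals of the order-`n` remainder along `A` and along `A′` equals the (1.23)-functional of the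
DIFFERENCE of the two remainders, at every admissible `(s, σ)` — §1's linearity with the integrand
`(t, s, σ) ↦ dirRem H n (A t s σ)` continuous by §2. [cite: Balaban1988RG2Cluster, (1.23) p.7] -/
theorem remPiece_sub_remPiece {ρ r R a : ℝ} {n : ℕ} (hρ : 1 < ρ) (hr : 0 < r) {H : E → F}
    (hH : DifferentiableOn ℂ H (ball 0 R)) (ha : 0 < a) (haR : a < R) (l : List ι)
    (A A' : ℂ → (ι → ℝ) → (ι → ℂ) → E)
    (hAc : ContinuousOn (fun p : ℂ × ((ι → ℝ) × (ι → ℂ)) => A p.1 p.2.1 p.2.2)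
      (sphere (0:ℂ) r ×ˢ {q | ∀ i ∈ l, q.1 i ∈ Icc (0:ℝ) 1 ∧ q.2 i ∈ sphere (0:ℂ) ρ}))
    (hA'c : ContinuousOn (fun p : ℂ × ((ι → ℝ) × (ι → ℂ)) => A' p.1 p.2.1 p.2.2)
      (sphere (0:ℂ) r ×ˢ {q | ∀ i ∈ l, q.1 i ∈ Icc (0:ℝ) 1 ∧ q.2 i ∈ sphere (0:ℂ) ρ}))
    (hA : ∀ t ∈ sphere (0:ℂ) r, ∀ s σ,
      (∀ i ∈ l, s i ∈ Icc (0:ℝ) 1 ∧ σ i ∈ sphere (0:ℂ) ρ) → ‖A t s σ‖ ≤ a)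
    (hA' : ∀ t ∈ sphere (0:ℂ) r, ∀ s σ,
      (∀ i ∈ l, s i ∈ Icc (0:ℝ) 1 ∧ σ i ∈ sphere (0:ℂ) ρ) → ‖A' t s σ‖ ≤ a)
    (s : ι → ℝ) (σ : ι → ℂ) (hsσ : ∀ i ∈ l, s i ∈ Icc (0:ℝ) 1 ∧ σ i ∈ sphere (0:ℂ) ρ) :
    remPiece ρ r l H n A s σ - remPiece ρ r l H n A' s σ =
      (2 * Real.pi * I : ℂ)⁻¹ • ∮ t in C(0, r), (t ^ 2)⁻¹ •
        cauchyOp ρ l (fun s' σ' => dirRem H n (A t s' σ') - dirRem H n (A' t s' σ')) s σ := by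
  have hD := continuousOn_dirRem hH ha haR n
  have hΦ : ∀ B : ℂ → (ι → ℝ) → (ι → ℂ) → E,
      ContinuousOn (fun p : ℂ × ((ι → ℝ) × (ι → ℂ)) => B p.1 p.2.1 p.2.2)
        (sphere (0:ℂ) r ×ˢ {q | ∀ i ∈ l, q.1 i ∈ Icc (0:ℝ) 1 ∧ q.2 i ∈ sphere (0:ℂ) ρ}) →
      (∀ t ∈ sphere (0:ℂ) r, ∀ s σ,
        (∀ i ∈ l, s i ∈ Icc (0:ℝ) 1 ∧ σ i ∈ sphere (0:ℂ) ρ) → ‖B t s σ‖ ≤ a) →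
      ContinuousOn (fun p : ℂ × ((ι → ℝ) × (ι → ℂ)) => dirRem H n (B p.1 p.2.1 p.2.2))
        (sphere (0:ℂ) r ×ˢ {q | ∀ i ∈ l, q.1 i ∈ Icc (0:ℝ) 1 ∧ q.2 i ∈ sphere (0:ℂ) ρ}) := by
    intro B hBc hB
    exact hD.comp hBc fun p hp => mem_closedBall_zero_iff.mpr (hB p.1 hp.1 p.2.1 p.2.2 hp.2)
  have key := pieceOp_sub hρ hr (fun s σ => ∀ i ∈ l, s i ∈ Icc (0:ℝ) 1 ∧ σ i ∈ sphere (0:ℂ) ρ) l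
    (movesClosed_constraint ρ l) (fun t s σ => dirRem H n (A t s σ)) (fun t s σ => dirRem H n (A' t s σ))
    (hΦ A hAc hA) (hΦ A' hA'c hA') s σ hsσ
  unfold remPiece
  exact key.symm

/-- **THE DISPLAYED SPECIES' PER-PIECE COUPLING RESPONSE IN CLOSED FORM (kernel; the theorem of this leaf).**  With
`ρ = e^{κ₁}`, `κ₁ ≥ 1`, the t_□-radius `r > 0`, an old term `H` analytic on `‖z‖ < R` with `‖H‖ ≤ M` there, `0 < a < R′ < R`, two
direction maps `A`, `A′` (↔ the shift 𝐇_k at two couplings — [I] (2.12) p. 268, [II] (1.21)–(1.23) p. 7, TYPE) CONTINUOUS ON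
THE CONTOURS, of norm `≤ a` and at distance `≤ δ` there (↔ `δ = a₁·|s − s′|`, the shift's Lipschitz modulus in the amplitude
— TYPE (1.21), displayed, asserted for nothing of Bałaban's):
`‖remPiece ρ r l H n A s σ − remPiece ρ r l H n A′ s σ‖ ≤ (1/r)·(2ⁿ·(2M/(R−R′))·(R′/a)·δ)·(a/R′)ⁿ)·exp(−(κ₁−1)·#l)` — p211959's
`norm_remPieceDiff_le` carried THROUGH the identity `remPiece_sub_remPiece`.  This is the displayed per-piece
coupling-response binder `hresp` of `NE9PieceCouplingModulus.channelCouplingModulus_piece` for the displayed species, at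
FORM level; the gain `(a/R′)^{n−1}` is kept.  NOT asserted: anything about Bałaban's 𝐇_k, the domain inclusions
(I.3.36)–(3.53), or that his (1.23) pieces are these `remPiece`s (O-NE9-1). [cite: Balaban1988RG2Cluster, (1.23)-(1.24) p.7;
Balaban1987RG1, (3.54) p.280] -/
theorem norm_remPiece_sub_remPiece_le {κ₁ r R R' M a δ : ℝ} {n : ℕ} (hκ : 1 ≤ κ₁) (hr : 0 < r) {H : E → F}
    (hH : DifferentiableOn ℂ H (ball 0 R)) (hM : ∀ z ∈ ball (0 : E) R, ‖H z‖ ≤ M) (ha : 0 < a) (haR' : a < R')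
    (hR'R : R' < R) (hδ : 0 ≤ δ) (l : List ι) (A A' : ℂ → (ι → ℝ) → (ι → ℂ) → E)
    (hAc : ContinuousOn (fun p : ℂ × ((ι → ℝ) × (ι → ℂ)) => A p.1 p.2.1 p.2.2)
      (sphere (0:ℂ) r ×ˢ {q | ∀ i ∈ l, q.1 i ∈ Icc (0:ℝ) 1 ∧ q.2 i ∈ sphere (0:ℂ) (Real.exp κ₁)}))
    (hA'c : ContinuousOn (fun p : ℂ × ((ι → ℝ) × (ι → ℂ)) => A' p.1 p.2.1 p.2.2)
      (sphere (0:ℂ) r ×ˢ {q | ∀ i ∈ l, q.1 i ∈ Icc (0:ℝ) 1 ∧ q.2 i ∈ sphere (0:ℂ) (Real.exp κ₁)}))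
    (hA : ∀ t ∈ sphere (0 : ℂ) r, ∀ s σ,
      (∀ i ∈ l, s i ∈ Icc (0 : ℝ) 1 ∧ σ i ∈ sphere (0 : ℂ) (Real.exp κ₁)) → ‖A t s σ‖ ≤ a)
    (hA' : ∀ t ∈ sphere (0 : ℂ) r, ∀ s σ,
      (∀ i ∈ l, s i ∈ Icc (0 : ℝ) 1 ∧ σ i ∈ sphere (0 : ℂ) (Real.exp κ₁)) → ‖A' t s σ‖ ≤ a)
    (hAA' : ∀ t ∈ sphere (0 : ℂ) r, ∀ s σ,
      (∀ i ∈ l, s i ∈ Icc (0 : ℝ) 1 ∧ σ i ∈ sphere (0 : ℂ) (Real.exp κ₁)) → ‖A t s σ - A' t s σ‖ ≤ δ)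
    (s : ι → ℝ) (σ : ι → ℂ) (hsσ : ∀ i ∈ l, s i ∈ Icc (0 : ℝ) 1 ∧ σ i ∈ sphere (0 : ℂ) (Real.exp κ₁)) :
    ‖remPiece (Real.exp κ₁) r l H n A s σ - remPiece (Real.exp κ₁) r l H n A' s σ‖ ≤
      (1 / r) * (2 ^ n * (2 * M / (R - R') * (R' / a) * δ) * (a / R') ^ n) * Real.exp (-(κ₁ - 1) * l.length) := by
  have hρ : 1 < Real.exp κ₁ := by
    have := Real.add_one_le_exp κ₁
    linarith
  rw [remPiece_sub_remPiece hρ hr hH ha (haR'.trans hR'R) l A A' hAc hA'c hA hA' s σ hsσ]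
  exact norm_remPieceDiff_le hκ hr hH hM ha haR' hR'R hδ l A A' hA hA' hAA' s σ hsσ

/-! ## §4 Non-vacuity of the new binders: an explicit direction map continuous on the contours -/

omit [CompleteSpace F] in
/-- The direction map `(t, s, σ) ↦ t•v + σ(Δ₀)•w` (a caricature of `(tζ̃_□ + t_□ζ_□)·𝐇_k(σ(Y₀), B′)`: linear in the outer
variable, reading one listed contour variable) is continuous on the contours — the NEW binder `hAc` of §3 is met by `fun_prop`.
[folklore] -/
example (v w : E) (i₀ : ι) (r ρ : ℝ) (l : List ι) :
    ContinuousOn (fun p : ℂ × ((ι → ℝ) × (ι → ℂ)) => p.1 • v + p.2.2 i₀ • w)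
      (sphere (0:ℂ) r ×ˢ {q | ∀ i ∈ l, q.1 i ∈ Icc (0:ℝ) 1 ∧ q.2 i ∈ sphere (0:ℂ) ρ}) :=
  Continuous.continuousOn (by fun_prop)

omit [CompleteSpace F] in
/-- … and, when `Δ₀` is listed, it has norm `≤ r‖v‖ + ρ‖w‖` on the contours — the binder `hA` of §3. [folklore] -/
example (v w : E) {i₀ : ι} {r ρ : ℝ} {l : List ι} (hi₀ : i₀ ∈ l) :
    ∀ t ∈ sphere (0:ℂ) r, ∀ (s : ι → ℝ) (σ : ι → ℂ),
      (∀ i ∈ l, s i ∈ Icc (0:ℝ) 1 ∧ σ i ∈ sphere (0:ℂ) ρ) → ‖t • v + σ i₀ • w‖ ≤ r * ‖v‖ + ρ * ‖w‖ := by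
  intro t ht s σ hsσ
  have h1 : ‖t‖ = r := by simpa using ht
  have h2 : ‖σ i₀‖ = ρ := by simpa using (hsσ i₀ hi₀).2
  calc ‖t • v + σ i₀ • w‖ ≤ ‖t • v‖ + ‖σ i₀ • w‖ := norm_add_le _ _
    _ = r * ‖v‖ + ρ * ‖w‖ := by rw [norm_smul, norm_smul, h1, h2]

end Species

end Summit.QuantumFields.BalabanUV.T4Continuum.NE9RemainderPieceLinear

end
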